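import Summits.BirchSwinnertonDyer.Uniform.UI.O2SigmaValuation
import Summits.BirchSwinnertonDyer.Rank1Residual.X11b.RegMultCertificateJoin
import Literature.NumberTheory.EllipticCurves.SteinWuthrich2013.NonsplitMultCanonicalHolds
import Literature.NumberTheory.EllipticCurves.PAdicHeightsLogProofs
import Literature.NumberTheory.EllipticCurves.PAdicHeightsProofs
import Literature.NumberTheory.EllipticCurves.CanonicalPAdicHeightAdmissibleProofs
import Literature.NumberTheory.EllipticCurves.CanonicalPAdicHeightJunkSigmaProofs
import HarnessLib

/-!
# Crux `SchneiderTamAtThree` (route `KolyvaginRoadThree`, item 19154): the closed form of the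
# non-split height at EVERY odd multiplicative prime — `ĥ_p(P) = 0 ⟺ U(P)^{p−1} = 1` and
# `‖ĥ_p(P)‖_p = ‖1 − U(P)^{p−1}‖_p` for the unit `U(P) = Σ²_E(P)/den x(P)`, the Tate-theta form of
# `Σ²_E(P)` in `ℂ_p`, and the per-curve dictionary `RegulatorNonvanishingAt W p ⟺` (∀ ∕ ∃ admissible
# point with `U^{p−1} ≠ 1`) at a non-split `p` in rank one (cell `bsd-stepL`, seat `bsd-stepL-tam3-p2`
# g0, WIDTH-LEVER second lane; `--supports stmt-BirchSwinnertonDyer-19154 --as helper`)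

HONEST FRAMING: nothing here proves the crux, Schneider's conjecture or BSD; 0 definitions, 0 named
facts, 0 sorry; route-independent (no Theses import). The `p = 3` closed form is the tree's
(cell `bsd-uniform`, seat `ui-o2`: `Uniform/UI/O2*` — `Σ² = tateSigmaValueSq`, `‖Σ²‖_p = ‖x‖_p⁻¹` and
`U = Σ²/den x` a unit at every odd `p` (`O2SigmaValuation`), and AT `p = 3`: `U ≡ 1 mod 3`,
`ĥ₃ = 0 ⟺ Σ² = den x`, `‖ĥ₃‖ = ‖U − 1‖`, `RegulatorNonvanishingAt W 3 ⟺ ∀∕∃ admissible Σ² ≠ den x`).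
This file adds what is NOT there and is uniform in the prime:

* `norm_tateP_eq_one`, `norm_tateTheta_eq` — in `ℂ_p` the Euler factors `P(q,v) = ∏(1 − qⁿ⁺¹v)` are
  `1`-units and `‖θ_q(u)‖ = ‖1 − u‖` on units (tree `tateP`, `tateTheta`, `hasProd_tateP`).
* `algebraMap_tateSigmaValueSq_eq_theta` — **`Σ²_E(P)` THROUGH THE TATE PARAMETRISATION**: for any
  integral `C • (W ⊗ ℂ_p) = E_q` with `‖u_C‖ = 1` and the one-unit parameter `υ` of the rational point
  `(x,y)` (`X_q(υ) = C.toX x`, `Y_q(υ) = C.toY x y`), `ι Σ²_E(P) = u_C⁻² · θ_q(υ)²/υ` — the tree's scale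
  identity `ι C² = u_C⁻²` (`algebraMap_uniformisationScaleSq`) times its value identity
  (`tateSigmaSq_coshOfSq_logUnitParamSq_eq_padicComplex`); with `norm_tateTheta_eq` and
  `norm_tateX_one_add` this re-proves `‖Σ²‖ = ‖1 − υ‖² = ‖x‖⁻¹` from the parametrisation side
  (`norm_tateSigmaValueSq_eq_inv_norm_x_of_theta`, second proof of ui-o2's theorem).
* `padicLog_eq_zero_iff_pow_eq_one_of_norm_eq_one`, `norm_padicLog_of_norm_eq_one` — for a unit `A`
  of `ℚ_p`, `p` odd: `log_p A = 0 ↔ A^{p−1} = 1` and `‖log_p A‖ = ‖1 − A^{p−1}‖` (Iwasawa: tree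
  `padicLog_of_ne_zero`, `eq_one_of_padicLogSeries_eq_zero`, `norm_padicLogSeries_eq`,
  `norm_one_sub_pow_sub_one_lt`).
* `heightFourOneCoord_eq_zero_iff_unit_pow_eq_one` — **`ĥ_p(x,y) = 0 ⟺ U(x,y)^{p−1} = 1`**;
  `norm_heightFourOneCoord_eq_norm_one_sub_unit_pow` — **`‖ĥ_p(x,y)‖_p = ‖1 − U(x,y)^{p−1}‖_p`**;
  `norm_heightFourOneCoord_lt_one` — `p ∣ ĥ_p` always; `pairing_self_eq_zero_iff_of_isMultCanonical`
  — the same for THE datum on admissible points. (`W` globally minimal, `Mult W p`, `p ≠ 2`,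
  `‖q‖ < 1`, `‖x‖_p > 1`; nothing else.)
* `regulatorNonvanishingAt_iff_forall_admissible_unit_pow_ne_one`,
  `regulatorNonvanishingAt_iff_exists_admissible_unit_pow_ne_one` — at a NON-split multiplicative
  `p ≠ 2` in Mordell–Weil rank one: `ClassClosure.RegulatorNonvanishingAt W p ⟺` every (resp. ONE)
  admissible point of THE Tate parameter has `U^{p−1} ≠ 1` — the `p`-generic shape of a REGCERT row
  (lane A's `p ≥ 5` universe v3: 22 480 pairs, two kernel rungs) and of ui-o2's `p = 3` dictionary.

So at every odd non-split multiplicative prime the Schneider input of the class record is ONE explicit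
`p`-adic unit per admissible point avoiding the `(p−1)`-st roots of unity; a table modulo `p^N`
decides exactly the pairs with `v_p(ĥ_p) < N` (at `p = 3`, lane A's 723 rows: `v₃ ∈ {1: 444, 2: 209,
3: 48, 4: 14, 5: 7, 7: 1}`); class-wide it is a transcendence-type avoidance statement
(`Uniform/UI/O2.TateSigmaIrrationalAtThree`; Bertrand 1982 settles only CM, never multiplicative).

References: [SteinWuthrich2013] §4.1 (4.1), §4.2 (pp. 15–16), Conj. 4.1; [SilvermanATAEC1994] Thm.
V.3.1, Prop. V.3.2, Thm. V.5.3; [Iwasawa1972PadicL] §4.4; [Schneider1982PadicHeightI] §1;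
tree `Uniform/UI/O2SigmaValuation.lean`, `SteinWuthrich2013/NonsplitMultCanonicalHolds.lean`,
`X11b/RegMultCertificateJoin.lean`.
-/

noncomputable section

open scoped Classical

open Filter Topology WeierstrassCurve Literature.NumberTheory.EllipticCurves
  Literature.NumberTheory.EllipticCurves.TateCurve
  Literature.NumberTheory.EllipticCurves.SteinWuthrich2013
  Literature.NumberTheory.EllipticCurves.Rank1Residual
  Summit.BirchSwinnertonDyer.Rank1Residual.X11b Summit.BirchSwinnertonDyer.Rank1Residual.X11b.ClassClosure
  Summit.BirchSwinnertonDyer.Uniform.UI.O2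

namespace Summit.BirchSwinnertonDyer.Rank1Residual.X11b.RegMult.SchneiderClosedFormOddPrime

variable {p : ℕ} [hp : Fact p.Prime]

/-! ### `ℂ_p`: `1`-units of the Tate product and the norm of the Tate theta function -/

/-- **The Euler factor `P(q,v) = ∏_{n≥1}(1 − qⁿv)` is a `1`-unit**: `‖P(q,v)‖ = 1` for `‖q‖ < 1`,
`‖v‖ ≤ 1` in `ℂ_p` (every partial product has norm `1`; the product converges, tree `hasProd_tateP`).
[cite: SilvermanATAEC1994, Thm. V.3.1 (PDF p. 395)] -/
theorem norm_tateP_eq_one {q v : ℂ_[p]} (hq : ‖q‖ < 1) (hv : ‖v‖ ≤ 1) : ‖tateP q v‖ = 1 := by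
  have h := hasProd_tateP hq v
  have hnorm : Tendsto (fun s : Finset ℕ => ‖∏ b ∈ s, (1 - q ^ (b + 1) * v)‖) atTop
      (𝓝 ‖tateP q v‖) := (continuous_norm.tendsto _).comp h
  have hconst : (fun s : Finset ℕ => ‖∏ b ∈ s, (1 - q ^ (b + 1) * v)‖) = fun _ => (1 : ℝ) := by
    funext s
    rw [norm_prod]
    refine Finset.prod_eq_one fun b _ => norm_one_sub_eq_one ?_
    rw [norm_mul, norm_pow]
    calc ‖q‖ ^ (b + 1) * ‖v‖ ≤ ‖q‖ ^ (b + 1) * 1 := by gcongr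
      _ < 1 := by rw [mul_one]; exact pow_lt_one₀ (norm_nonneg q) hq (Nat.succ_ne_zero b)
  rw [hconst] at hnorm
  exact tendsto_nhds_unique hnorm tendsto_const_nhds

/-- **Norm of the Tate theta function on units**: `‖θ_q(u)‖ = ‖1 − u‖` for `‖q‖ < 1`, `‖u‖ = 1` in
`ℂ_p` (`θ_q(u) = (1 − u)P(q,u)P(q,u⁻¹)/P(q,1)²`, tree `tateTheta`).
[cite: SilvermanATAEC1994, Prop. V.3.2 (PDF p. 399)] -/
theorem norm_tateTheta_eq {q u : ℂ_[p]} (hq : ‖q‖ < 1) (hu : ‖u‖ = 1) :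
    ‖tateTheta q u‖ = ‖1 - u‖ := by
  unfold tateTheta
  rw [norm_div, norm_mul, norm_mul, norm_pow, norm_tateP_eq_one hq hu.le,
    norm_tateP_eq_one hq (by rw [norm_inv, hu, inv_one]), norm_tateP_eq_one hq (by simp)]
  simp

/-- `‖(x : ℂ_p)‖ = ‖x‖_p` for the embedding `ℚ_p → ℂ_p`. [folklore] -/
private theorem norm_ι (x : ℚ_[p]) : ‖algebraMap ℚ_[p] ℂ_[p] x‖ = ‖x‖ := norm_algebraMap' ℂ_[p] x

/-! ### `Σ²_E(P)` through the Tate parametrisation (in `ℂ_p`) -/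

section TateParametrisation

variable {W : WeierstrassCurve ℚ} [W.IsElliptic] [W.IsGloballyMinimal]

/-- **`Σ²_E(P) = u_C⁻² θ_q(υ)²/υ` in `ℂ_p`**: for `W/ℚ` globally minimal, multiplicative at `p ≠ 2`,
`q ≠ 0`, `‖q‖ < 1`, ANY integral change of variables `C` over `ℂ_p` with `C • (W ⊗ ℂ_p) = E_q`,
`‖u_C‖ = 1`, and a one-unit `υ ≠ 1`, `‖υ − 1‖ ≤ p⁻¹`, parametrising the rational point `(x,y)`:
`ι(tateSigmaValueSq W p q x y) = u_C⁻² · θ_q(υ)²/υ` (the tree's `algebraMap_uniformisationScaleSq` and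
`tateSigmaSq_coshOfSq_logUnitParamSq_eq_padicComplex`, multiplied). This is the closed form "from the
Tate parametrisation" of the number whose Iwasawa logarithm is `log_p den x − ĥ_p(P)`.
[cite: SteinWuthrich2013, §4.2 (p. 15)] [cite: SilvermanATAEC1994, Prop. V.3.2 (b) (PDF p. 399)] -/
theorem algebraMap_tateSigmaValueSq_eq_theta (hp2 : p ≠ 2) (hW : Mult W p) {q : ℚ_[p]}
    (hq0 : q ≠ 0) (hq : ‖q‖ < 1) {C : VariableChange ℂ_[p]}
    (hC : C • (W.baseChange ℚ_[p]).map (algebraMap ℚ_[p] ℂ_[p]) = tateCurve (algebraMap ℚ_[p] ℂ_[p] q))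
    (hu : ‖(C.u : ℂ_[p])‖ = 1) (hr : ‖C.r‖ ≤ 1) (hs : ‖C.s‖ ≤ 1) (ht : ‖C.t‖ ≤ 1) {x y : ℚ}
    (hxy : W.toAffine.Nonsingular x y) {υ : ℂ_[p]} (hυ1 : ‖υ - 1‖ ≤ (p : ℝ)⁻¹) (hυne : υ ≠ 1)
    (hX : tateX (algebraMap ℚ_[p] ℂ_[p] q) υ = C.toX (algebraMap ℚ_[p] ℂ_[p] (x : ℚ_[p])))
    (hY : tateY (algebraMap ℚ_[p] ℂ_[p] q) υ =
      C.toY (algebraMap ℚ_[p] ℂ_[p] (x : ℚ_[p])) (algebraMap ℚ_[p] ℂ_[p] (y : ℚ_[p]))) :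
    algebraMap ℚ_[p] ℂ_[p] (tateSigmaValueSq W p q x y) =
      ((C.u : ℂ_[p])⁻¹) ^ 2 * (tateTheta (algebraMap ℚ_[p] ℂ_[p] q) υ ^ 2 / υ) := by
  have hj1 := one_lt_norm_j_of_hasMultiplicativeReductionAtPrime (W := W) (p := p) hW
  unfold tateSigmaValueSq
  rw [map_mul, algebraMap_uniformisationScaleSq hq hC hj1,
    tateSigmaSq_coshOfSq_logUnitParamSq_eq_padicComplex hp2 hq0 hq hj1 hC hu hr hs ht hxy hυ1
      hυne hX hY]

/-- **`‖Σ²_E(P)‖_p = ‖x(P)‖_p⁻¹` from the parametrisation side** (second proof of ui-o2's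
`norm_tateSigmaValueSq_eq_inv_norm_x`, for THE Tate parameter `q`, `j(q) = j(W)`): in `ℂ_p`,
`‖u_C⁻²θ_q(υ)²/υ‖ = ‖1 − υ‖²` (`norm_tateTheta_eq`) and `‖1 − υ‖⁻² = ‖X_q(υ)‖ = ‖C.toX x‖ = ‖x‖_p`
(`norm_tateX_one_add`; `‖u_C‖ = 1`, `‖r_C‖ ≤ 1 < ‖x‖`) on the data of
`exists_nonsplitUniformizationData`. [cite: SteinWuthrich2013, §4.2 (p. 15)]
[cite: SilvermanATAEC1994, Thm. V.3.1 (c), Thm. V.5.3 (PDF pp. 395–409)] -/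
theorem norm_tateSigmaValueSq_eq_inv_norm_x_of_theta (hp2 : p ≠ 2) (hW : Mult W p) {q : ℚ_[p]}
    (hq0 : q ≠ 0) (hq : ‖q‖ < 1) (hj : tateJ q = (W.j : ℚ_[p])) {x y : ℚ}
    (hxy : W.toAffine.Nonsingular x y) (hx : 1 < ‖(x : ℚ_[p])‖) :
    ‖tateSigmaValueSq W p q x y‖ = ‖(x : ℚ_[p])‖⁻¹ := by
  set ι := algebraMap ℚ_[p] ℂ_[p] with hι
  have hpinv1 : (p : ℝ)⁻¹ < 1 := inv_lt_one_of_one_lt₀ (by exact_mod_cast hp.out.one_lt)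
  obtain ⟨C, υ, hC, hu, hr, hs, ht, hυ, -, -⟩ := exists_nonsplitUniformizationData hp2 hW hq0 hq hj
  obtain ⟨-, hυ1, hυne, -, hX, hY⟩ := hυ hxy hx
  have hval := algebraMap_tateSigmaValueSq_eq_theta hp2 hW hq0 hq hC hu hr hs ht hxy hυ1 hυne hX hY
  have hq' : ‖ι q‖ < 1 := by rw [norm_ι]; exact hq
  have hυlt : ‖υ x y - 1‖ < 1 := hυ1.trans_lt hpinv1
  have hυn : ‖υ x y‖ = 1 := norm_eq_one_of_norm_sub_one_lt hυlt
  set t : ℂ_[p] := υ x y - 1 with ht_def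
  have ht0 : t ≠ 0 := sub_ne_zero.mpr hυne
  have hυt : υ x y = 1 + t := by rw [ht_def]; ring
  have hXn : ‖tateX (ι q) (1 + t)‖ = ‖t‖⁻¹ ^ 2 := norm_tateX_one_add hq' ht0 hυlt
  have htoX : ‖C.toX (ι (x : ℚ_[p]))‖ = ‖(x : ℚ_[p])‖ := by
    rw [VariableChange.toX_def, norm_mul, norm_pow, Units.val_inv_eq_inv_val, norm_inv, hu,
      inv_one, one_pow, one_mul]
    have hx' : 1 < ‖ι (x : ℚ_[p])‖ := by rw [norm_ι]; exact hx
    have hne : ‖ι (x : ℚ_[p])‖ ≠ ‖-C.r‖ := by rw [norm_neg]; exact (hr.trans_lt hx').ne'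
    rw [sub_eq_add_neg, IsUltrametricDist.norm_add_eq_max_of_norm_ne_norm hne,
      max_eq_left (by rw [norm_neg]; exact (hr.trans_lt hx').le), norm_ι]
  have ht2 : ‖t‖ ^ 2 = ‖(x : ℚ_[p])‖⁻¹ := by
    rw [← hυt, hX, htoX, inv_pow] at hXn
    rw [← inv_inv (‖t‖ ^ 2), hXn]
  rw [← norm_ι, hval, norm_mul, norm_div, norm_pow, norm_pow, norm_inv, hu, hυn,
    norm_tateTheta_eq hq' hυn, inv_one, one_pow, one_mul, div_one, ← ht2, ht_def, norm_sub_rev]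

end TateParametrisation

/-! ### The Iwasawa logarithm on units of `ℚ_p`, `p` odd: kernel and exact norm -/

/-- **Kernel of `log_p` on units (`p ≠ 2`)**: for `‖A‖_p = 1`, `log_p A = 0 ↔ A^{p−1} = 1`
(`log_p A = (p−1)⁻¹ L(A^{p−1})`, `A^{p−1} ∈ 1 + pℤ_p`, and `L` is injective there since `‖2‖_p = 1`).
[cite: Iwasawa1972PadicL, §4.4] -/
theorem padicLog_eq_zero_iff_pow_eq_one_of_norm_eq_one (hp2 : p ≠ 2) {A : ℚ_[p]}
    (hA : ‖A‖ = 1) : padicLog p A = 0 ↔ A ^ (p - 1) = 1 := by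
  have hA0 : A ≠ 0 := norm_pos_iff.mp (by rw [hA]; exact one_pos)
  have hv : A.valuation = 0 := valuation_eq_of_norm_eq hA0 (n := 0) (by simpa using hA)
  have h2 : ‖(2 : ℚ_[p])‖ = 1 := by
    rw [show (2 : ℚ_[p]) = ((2 : ℕ) : ℚ_[p]) by norm_cast, Padic.norm_natCast_eq_one_iff]
    exact (Nat.coprime_primes hp.out Nat.prime_two).mpr hp2
  have hy : ‖1 - A ^ (p - 1)‖ < ‖(2 : ℚ_[p])‖ := by
    rw [h2]; exact norm_one_sub_pow_sub_one_lt hA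
  rw [padicLog_of_ne_zero hA0, hv, neg_zero, zpow_zero, mul_one, mul_eq_zero,
    or_iff_right (inv_ne_zero natCast_prime_sub_one_ne_zero)]
  exact ⟨eq_one_of_padicLogSeries_eq_zero hy, fun h => by rw [h, padicLogSeries_one]⟩

/-- **Exact norm of `log_p` on units (`p ≠ 2`)**: for `‖A‖_p = 1`, `‖log_p A‖_p = ‖1 − A^{p−1}‖_p`
(Iwasawa's isometry on `1 + pℤ_p`; `‖(p−1)⁻¹‖_p = 1`). [cite: Iwasawa1972PadicL, §4.4] -/
theorem norm_padicLog_of_norm_eq_one (hp2 : p ≠ 2) {A : ℚ_[p]} (hA : ‖A‖ = 1) :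
    ‖padicLog p A‖ = ‖1 - A ^ (p - 1)‖ := by
  have hA0 : A ≠ 0 := norm_pos_iff.mp (by rw [hA]; exact one_pos)
  have hv : A.valuation = 0 := valuation_eq_of_norm_eq hA0 (n := 0) (by simpa using hA)
  have h2 : ‖(2 : ℚ_[p])‖ = 1 := by
    rw [show (2 : ℚ_[p]) = ((2 : ℕ) : ℚ_[p]) by norm_cast, Padic.norm_natCast_eq_one_iff]
    exact (Nat.coprime_primes hp.out Nat.prime_two).mpr hp2
  have hy : ‖1 - A ^ (p - 1)‖ < ‖(2 : ℚ_[p])‖ := by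
    rw [h2]; exact norm_one_sub_pow_sub_one_lt hA
  have hp1 : ‖((p : ℚ_[p]) - 1)⁻¹‖ = 1 := by
    rw [norm_inv, norm_sub_rev, norm_one_sub_eq_one (Padic.norm_p_lt_one), inv_one]
  rw [padicLog_of_ne_zero hA0, hv, neg_zero, zpow_zero, mul_one, norm_mul, hp1, one_mul,
    norm_padicLogSeries_eq hy]

/-! ### The height at an odd multiplicative prime: zero criterion and exact size -/

section OddPrime

variable {W : WeierstrassCurve ℚ} [W.IsElliptic] [W.IsGloballyMinimal]

/-- **`ĥ_p(x,y) = 0 ⟺ U(x,y)^{p−1} = 1`**, `U = Σ²_E/den x`, for `W` globally minimal with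
multiplicative reduction at the odd prime `p`, any `q` with `‖q‖_p < 1`, and any rational point with
`‖x‖_p > 1` (ui-o2's closed form `ĥ_p = −log_p U` + the kernel of `log_p` on units). At `p = 3` this
is `U² = 1`, refined to `U = 1` by ui-o2's `heightFourOneCoord_eq_zero_iff_eq_den` (`U ≡ 1 mod 3`).
[cite: SteinWuthrich2013, §4.1 eq. (4.1), §4.2] [cite: Iwasawa1972PadicL, §4.4] -/
theorem heightFourOneCoord_eq_zero_iff_unit_pow_eq_one (hp2 : p ≠ 2) (hW : Mult W p) {q : ℚ_[p]}
    (hq : ‖q‖ < 1) {x y : ℚ} (hxy : W.toAffine.Nonsingular x y) (hx : 1 < ‖(x : ℚ_[p])‖) :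
    heightFourOneCoord W p q x y = 0 ↔
      (tateSigmaValueSq W p q x y / ((x.den : ℚ) : ℚ_[p])) ^ (p - 1) = 1 := by
  rw [heightFourOneCoord_eq_neg_padicLog_div_den hp2 hW hq hxy hx, neg_eq_zero,
    padicLog_eq_zero_iff_pow_eq_one_of_norm_eq_one hp2
      (norm_tateSigmaValueSq_div_den_eq_one hp2 hW hq hxy hx)]

/-- **`‖ĥ_p(x,y)‖_p = ‖1 − U(x,y)^{p−1}‖_p`** under the same hypotheses: the `p`-adic size of the
height IS the `p`-adic distance of `U^{p−1}` from `1`; a certificate "`ĥ_p ≠ 0` at precision `p^N`"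
is exactly `U^{p−1} ≢ 1 (mod p^N)`. [cite: SteinWuthrich2013, §4.2] [cite: Iwasawa1972PadicL, §4.4] -/
theorem norm_heightFourOneCoord_eq_norm_one_sub_unit_pow (hp2 : p ≠ 2) (hW : Mult W p) {q : ℚ_[p]}
    (hq : ‖q‖ < 1) {x y : ℚ} (hxy : W.toAffine.Nonsingular x y) (hx : 1 < ‖(x : ℚ_[p])‖) :
    ‖heightFourOneCoord W p q x y‖ =
      ‖1 - (tateSigmaValueSq W p q x y / ((x.den : ℚ) : ℚ_[p])) ^ (p - 1)‖ := by
  rw [heightFourOneCoord_eq_neg_padicLog_div_den hp2 hW hq hxy hx, norm_neg,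
    norm_padicLog_of_norm_eq_one hp2 (norm_tateSigmaValueSq_div_den_eq_one hp2 hW hq hxy hx)]

/-- **`p ∣ ĥ_p(x,y)` for every pair**: `‖ĥ_p(x,y)‖_p < 1` (`U^{p−1} ≡ 1 mod p` for every unit, so no
residue modulo `p` is informative; the first informative digit is modulo `p²`).
[cite: SteinWuthrich2013, §4.2] -/
theorem norm_heightFourOneCoord_lt_one (hp2 : p ≠ 2) (hW : Mult W p) {q : ℚ_[p]} (hq : ‖q‖ < 1)
    {x y : ℚ} (hxy : W.toAffine.Nonsingular x y) (hx : 1 < ‖(x : ℚ_[p])‖) :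
    ‖heightFourOneCoord W p q x y‖ < 1 := by
  rw [norm_heightFourOneCoord_eq_norm_one_sub_unit_pow hp2 hW hq hxy hx]
  exact norm_one_sub_pow_sub_one_lt (norm_tateSigmaValueSq_div_den_eq_one hp2 hW hq hxy hx)

/-- **On THE datum** (`IsMultCanonical Dh q`, admissible `P = (x,y)`): `⟨P,P⟩ = 0 ⟺ U(P)^{p−1} = 1`.
[cite: SteinWuthrich2013, §4.2, Conj. 4.1] -/
theorem pairing_self_eq_zero_iff_of_isMultCanonical (hp2 : p ≠ 2) (hW : Mult W p) {q : ℚ_[p]}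
    (hq : ‖q‖ < 1) {Dh : PAdicHeightData W p} (hDh : IsMultCanonical Dh q) {x y : ℚ}
    {h : W.toAffine.Nonsingular x y} (hadm : W.IsAdmissible p (.some x y h)) :
    Dh.pairing (.some x y h) (.some x y h) = 0 ↔
      (tateSigmaValueSq W p q x y / ((x.den : ℚ) : ℚ_[p])) ^ (p - 1) = 1 := by
  rw [hDh _ hadm]
  exact heightFourOneCoord_eq_zero_iff_unit_pow_eq_one hp2 hW hq h hadm.2.1

/-! ### The per-curve dictionary at a non-split odd multiplicative prime, rank one -/

/-- **`RegulatorNonvanishingAt W p ⟺ U^{p−1} ≠ 1` on every admissible point** (for `W` globally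
minimal, NON-split multiplicative at the odd prime `p`, Mordell–Weil rank one): the non-split half of
the lever's per-pair input quantifies over THE Tate parameter `q` and THE datum `Dh`
(`IsMultCanonical Dh q`); in rank one `Reg_p ≠ 0 ⟺ ⟨P,P⟩ ≠ 0` on non-torsion points
(`schneider_iff_forall_pairing_self_ne_zero`), every non-torsion point has an admissible multiple
(`exists_admissible_nsmul_holds`, `pairing_nsmul_nsmul`), THE datum exists
(`exists_isMultCanonical_holds`), and the zero criterion converts; the split half is vacuous
(`TateParameterData.split`). [cite: SteinWuthrich2013, §4.2, Conj. 4.1]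
[cite: Schneider1982PadicHeightI, §1] -/
theorem regulatorNonvanishingAt_iff_forall_admissible_unit_pow_ne_one (hp2 : p ≠ 2) (hW : Mult W p)
    (hns : ¬ W.HasSplitMultiplicativeReductionAtPrime p) (hr : W.mordellWeilRank = 1) :
    RegulatorNonvanishingAt W p ↔
      ∀ (q : ℚ_[p]), q ≠ 0 → ‖q‖ < 1 → tateJ q = (W.j : ℚ_[p]) →
      ∀ (x y : ℚ) (h : W.toAffine.Nonsingular x y), W.IsAdmissible p (.some x y h) →
        (tateSigmaValueSq W p q x y / ((x.den : ℚ) : ℚ_[p])) ^ (p - 1) ≠ 1 := by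
  constructor
  · intro hreg q hq0 hq1 hj x y hxy hadm hU
    obtain ⟨Dh, hDh⟩ := exists_isMultCanonical_holds W p hp2 hW hns q hq0 hq1 hj
    have hS : SchneiderConjecture Dh := hreg.1 q Dh hq0 hq1 hj hDh
    have hne := heightFourOne_ne_zero_of_schneider hr hDh hS hadm
    rw [heightFourOne_some] at hne
    exact hne ((heightFourOneCoord_eq_zero_iff_unit_pow_eq_one hp2 hW hq1 hxy hadm.2.1).mpr hU)
  · intro hU
    refine ⟨fun q Dh hq0 hq1 hj hDh => ?_, fun Dq _ _ => absurd Dq.split hns⟩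
    refine (schneider_iff_forall_pairing_self_ne_zero Dh hr).mpr fun P hP hPP => ?_
    obtain ⟨m, -, hadm⟩ := exists_admissible_nsmul_holds W p P hP
    have hmm : Dh.pairing (m • P) (m • P) = 0 := by rw [pairing_nsmul_nsmul, hPP, mul_zero]
    revert hadm hmm
    rcases m • P with _ | ⟨x, y, hxy⟩
    · intro hadm; exact absurd hadm.2 id
    · intro hadm hmm
      exact hU q hq0 hq1 hj x y hxy hadm
        ((pairing_self_eq_zero_iff_of_isMultCanonical hp2 hW hq1 hDh hadm).mp hmm)

/-- **ONE admissible point decides** (same hypotheses): `RegulatorNonvanishingAt W p ⟺` there are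
THE Tate parameter `q` and ONE admissible point with `U^{p−1} ≠ 1` — the exact content of one
REGCERT row at a non-split odd `p` (lane A's v2 ∕ v3 universes), by uniqueness of the Tate parameter
(`existsUnique_tateJ_eq_holds`) and `schneider_of_isMultCanonical_of_heightFourOne_ne_zero`.
[cite: SteinWuthrich2013, §4.2, §7] [cite: SilvermanATAEC1994, Lemma V.5.1] -/
theorem regulatorNonvanishingAt_iff_exists_admissible_unit_pow_ne_one (hp2 : p ≠ 2) (hW : Mult W p)
    (hns : ¬ W.HasSplitMultiplicativeReductionAtPrime p) (hr : W.mordellWeilRank = 1) :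
    RegulatorNonvanishingAt W p ↔
      ∃ (q : ℚ_[p]), q ≠ 0 ∧ ‖q‖ < 1 ∧ tateJ q = (W.j : ℚ_[p]) ∧
      ∃ (x y : ℚ) (h : W.toAffine.Nonsingular x y), W.IsAdmissible p (.some x y h) ∧
        (tateSigmaValueSq W p q x y / ((x.den : ℚ) : ℚ_[p])) ^ (p - 1) ≠ 1 := by
  have hj1 : 1 < ‖(W.j : ℚ_[p])‖ := one_lt_norm_j_of_hasMultiplicativeReductionAtPrime hW
  constructor
  · intro hreg
    have hall := (regulatorNonvanishingAt_iff_forall_admissible_unit_pow_ne_one hp2 hW hns hr).mp hreg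
    obtain ⟨q, ⟨hq0, hq1, hj⟩, -⟩ := existsUnique_tateJ_eq_holds p hj1
    obtain ⟨P₀, hP₀⟩ :=
      exists_not_isOfFinAddOrder_of_mordellWeilRank_ne_zero (W := W) (by omega)
    obtain ⟨m, -, hadm⟩ := exists_admissible_nsmul_holds W p P₀ hP₀
    revert hadm
    rcases m • P₀ with _ | ⟨x, y, h⟩
    · intro hadm; exact absurd hadm.2 id
    · intro hadm
      exact ⟨q, hq0, hq1, hj, x, y, h, hadm, hall q hq0 hq1 hj x y h hadm⟩
  · rintro ⟨q₀, hq0, hq1, hj, x, y, h, hadm, hne⟩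
    refine ⟨fun q Dh hq0' hq1' hj' hDh => ?_, fun Dq _ _ => absurd Dq.split hns⟩
    have hqq : q = q₀ :=
      (existsUnique_tateJ_eq_holds p hj1).unique ⟨hq0', hq1', hj'⟩ ⟨hq0, hq1, hj⟩
    subst hqq
    refine schneider_of_isMultCanonical_of_heightFourOne_ne_zero hr hDh hadm ?_
    rw [heightFourOne_some]
    exact fun h0 => hne ((heightFourOneCoord_eq_zero_iff_unit_pow_eq_one hp2 hW hq1 h hadm.2.1).mp h0)

end OddPrime

end Summit.BirchSwinnertonDyer.Rank1Residual.X11b.RegMult.SchneiderClosedFormOddPrime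

end
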